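import Summits.QuantumAdvantage.QuantumAdvantage.Theorems.MobiusLadderLiouvilleNotAC0Xor

/-!
# Weak glue for the `AC⁰[⊕]` rung: one-sided constant-error inapproximability suffices

Support of line Sketch/LAR of crux stmt-QuantumAdvantage-1392 (`DigitPolyUniformity`), stub W1
`liouvilleNotAC0Xor_of_inapprox`.

The route consumes the crux only through the Razborov–Smolensky glue
`LiouvilleNotAC0Xor : DigitPolyUniformity → L_λ ∉ AC0Mod 2`
(`Theorems/MobiusLadderLiouvilleNotAC0Xor.lean`, `LiouvilleNotAC0Xor_proof`). This file records that
the rung needs much less than the crux: it suffices that for SOME constant `c > 0`, for every `A`,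
eventually in `n`, every `P ∈ 𝔽₂[x_0, …, x_{n-1}]` of total degree `≤ (log₂ n)^A` satisfies the
ONE-SIDED bound on the TOP dyadic block

  `Σ_{2^{n-1} ≤ N < 2ⁿ} λ(N) (−1)^{[P(bits N) = 1]} ≤ (1/2 − c) · 2ⁿ`.

## Proof
The proof of `LiouvilleNotAC0Xor_proof` run with error `2^{-t}` (`2 < c · 2^t`) instead of `1/8`.
Suppose a circuit family `(Cₙ)` over `accBasis 2` of depth `≤ d` and size `≤ p(n) ≤ n^k`
(`k = deg p + 1`) decides `L_λ = {bin(N) : λ(N) = −1}`. With `ℓ = k (log₂ n + 1) + t`, the tree's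
Razborov–Smolensky lemma (`Smolensky.razborov_smolensky`) gives a function in Smolensky's degree
filtration of degree `≤ ℓ^d ≤ (2(k+t))^d (log₂ n)^d ≤ (log₂ n)^{d+1}` (once `log₂ n ≥ (2(k+t))^d`),
hence (`exists_mvPolynomial_of_mem_lowDeg`) an honest polynomial `P` of that total degree, agreeing
with `Cₙ` off an error set `E` with `|E| · 2^ℓ ≤ n^k · 2ⁿ`, so `|E| · 2^t ≤ 2ⁿ`. On the top block
`T = [2^{n-1}, 2ⁿ)` the `n` low bits of `N` are exactly the code word `encodeNat N`
(`encodeNat_eq_ofFn`, `ofFn_mem_toLanguage_iff`), so `Cₙ(bits N) = [λ(N) = −1]` and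
`λ(N) χ_P(N) = 1` off `E`, `≥ −1` on `E` (`λ(N) = ±1` for `N ≠ 0`). Hence (`card_sub_le_sum`,
`testBit_injOn`) `Σ_T λ χ_P ≥ |T| − 2|E| = 2^{n-1} − 2|E| > (1/2 − c) 2ⁿ`, since
`2|E| ≤ 2 · 2ⁿ / 2^t < c · 2ⁿ` — contradicting the hypothesis (used with `A = d + 1`).

No property of `λ` beyond `λ(N) ∈ {±1}` for `N ≠ 0` is used. The hypothesis is strictly weaker than
the crux (a fixed constant instead of every `ε`; one block; one side).
-/

namespace Summit.QuantumAdvantage.DigitPolyUniformity.SketchLAR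

open Filter Finset
open Literature.Computability.Complexity Literature.Computability.MetaComplexity
open Summit.QuantumAdvantage.QuantumAdvantage.Theorems.MobiusLadder

/-- **Weak glue (stub W1 of line Sketch/LAR, crux stmt-QuantumAdvantage-1392).** If for some
constant `c > 0`, for every `A`, eventually in `n`, every `P ∈ 𝔽₂[x_0, …, x_{n-1}]` of total degree
`≤ (log₂ n)^A` has `Σ_{2^{n-1} ≤ N < 2ⁿ} λ(N) (−1)^{[P(bits N) = 1]} ≤ (1/2 − c) 2ⁿ` (i.e. `[P = 1]`
agrees with `[λ = −1]` on at most a `(1 − c)` fraction of the top dyadic block), then the Liouville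
language `{bin(N) : λ(N) = −1}` is not in `AC⁰[⊕] = AC0Mod 2`.

Proof: the Razborov–Smolensky glue of `LiouvilleNotAC0Xor_proof` with error `2^{-t}`, `2 < c 2^t`:
a deciding circuit family of depth `d` and size `≤ n^k` yields, via `Smolensky.razborov_smolensky`
with `ℓ = k (log₂ n + 1) + t`, a polynomial `P` of total degree `≤ ℓ^d ≤ (log₂ n)^{d+1}` agreeing
with `[λ = −1]` on the top block off a set `E` with `|E| 2^t ≤ 2ⁿ`, whence
`Σ_top λ χ_P ≥ 2^{n-1} − 2|E| > (1/2 − c) 2ⁿ`. (Smolensky 1987, Lemmas 1–2, as imported.) -/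
theorem liouvilleNotAC0Xor_of_inapprox :
    (∃ c : ℝ, 0 < c ∧ ∀ A : ℕ, ∀ᶠ n : ℕ in atTop, ∀ P : MvPolynomial (Fin n) (ZMod 2),
        P.totalDegree ≤ Nat.log 2 n ^ A →
          ∑ N ∈ Finset.Ico (2 ^ (n - 1)) (2 ^ n), ((ArithmeticFunction.liouville N : ℤ) : ℝ) *
              (if MvPolynomial.eval (fun i : Fin n => if Nat.testBit N i then (1 : ZMod 2) else 0) P = 1
                then (-1 : ℝ) else 1) ≤ (1 / 2 - c) * (2 : ℝ) ^ n) →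
      Computability.encodingNatBool.toLanguage {N : ℕ | ArithmeticFunction.liouville N = -1} ∉
        Literature.Computability.Complexity.AC0Mod 2 := by
  rintro ⟨c, hc, hW⟩ hL
  obtain ⟨d, p, C, hC, hdec⟩ := hL
  -- the error exponent `t`: `2 < c · 2^t`
  obtain ⟨t, ht⟩ : ∃ t : ℕ, (2 : ℝ) < c * 2 ^ t := by
    obtain ⟨t, ht⟩ := exists_nat_gt (2 / c)
    have h2t : (t : ℝ) < 2 ^ t := by exact_mod_cast Nat.lt_two_pow_self
    refine ⟨t, ?_⟩
    rw [mul_comm]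
    exact (div_lt_iff₀ hc).1 (ht.trans h2t)
  set k : ℕ := p.natDegree + 1 with hk
  set c' : ℕ := 2 * (k + t) with hc'
  have hpoly : ∀ᶠ m : ℕ in atTop, p.eval m ≤ m ^ k := by
    refine (eventually_ge_atTop (max 1 (p.eval 1))).mono fun m hm => ?_
    calc p.eval m ≤ p.eval 1 * m ^ p.natDegree :=
          natPoly_eval_le_eval_one_mul_pow p (le_of_max_le_left hm)
      _ ≤ m * m ^ p.natDegree := Nat.mul_le_mul_right _ (le_of_max_le_right hm)
      _ = m ^ k := by rw [hk, pow_succ']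
  obtain ⟨n, hn1, hn2, hn3⟩ :=
    ((hW (d + 1)).and (hpoly.and (eventually_ge_atTop (2 ^ (c' ^ d))))).exists
  have hcd : 1 ≤ c' ^ d := Nat.one_le_pow _ _ (by omega)
  have hlog : c' ^ d ≤ Nat.log 2 n := Nat.le_log_of_pow_le one_lt_two hn3
  have hlog1 : 1 ≤ Nat.log 2 n := hcd.trans hlog
  have hn0 : n ≠ 0 := by
    rintro rfl
    simp at hlog1
  have hn2' : 2 ≤ n := by simpa using Nat.pow_le_of_le_log hn0 hlog1
  obtain ⟨hover, hdepth, hsize⟩ := hC n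
  -- Razborov–Smolensky at length `n`
  set ℓ : ℕ := k * (Nat.log 2 n + 1) + t with hℓ
  have hkℓ : k ≤ k * (Nat.log 2 n + 1) := Nat.le_mul_of_pos_right k (Nat.succ_pos _)
  have hℓ1 : 1 ≤ ℓ := by omega
  obtain ⟨Pf, E, hPf, hE, hagree⟩ := Smolensky.razborov_smolensky (C n) hover hℓ1
  have hℓc : ℓ ≤ c' * Nat.log 2 n := by
    have h2 : k + t ≤ (k + t) * Nat.log 2 n := Nat.le_mul_of_pos_right _ hlog1
    rw [hℓ, hc']
    nlinarith [h2, Nat.zero_le (t * Nat.log 2 n)]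
  have hdeg : ((2 - 1) * ℓ) ^ (C n).acDepth ≤ Nat.log 2 n ^ (d + 1) := by
    rw [show (2 - 1) * ℓ = ℓ by omega]
    calc ℓ ^ (C n).acDepth ≤ ℓ ^ d := Nat.pow_le_pow_right hℓ1 hdepth
      _ ≤ (c' * Nat.log 2 n) ^ d := Nat.pow_le_pow_left hℓc d
      _ = c' ^ d * Nat.log 2 n ^ d := mul_pow _ _ _
      _ ≤ Nat.log 2 n * Nat.log 2 n ^ d := Nat.mul_le_mul_right _ hlog
      _ = Nat.log 2 n ^ (d + 1) := (pow_succ' _ _).symm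
  obtain ⟨P, hPdeg, hPeval⟩ :=
    exists_mvPolynomial_of_mem_lowDeg (Smolensky.lowDeg_mono hdeg hPf)
  -- the error set is small: `|E| · 2^t ≤ 2ⁿ`
  have hEt : E.card * 2 ^ t ≤ 2 ^ n := by
    have h1 : n ^ k < 2 ^ (k * (Nat.log 2 n + 1)) := by
      rw [pow_mul']
      exact Nat.pow_lt_pow_left (Nat.lt_pow_succ_log_self one_lt_two n) (by omega)
    have h2 : 2 ^ ℓ = 2 ^ (k * (Nat.log 2 n + 1)) * 2 ^ t := by
      rw [hℓ, pow_add]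
    have h3 : E.card * 2 ^ ℓ ≤ n ^ k * 2 ^ n :=
      hE.trans (Nat.mul_le_mul_right _ (hsize.trans hn2))
    have h4 : E.card * (n ^ k * 2 ^ t) ≤ E.card * 2 ^ ℓ := by
      rw [h2]
      exact Nat.mul_le_mul_left _ (Nat.mul_le_mul_right _ h1.le)
    have hnk : 0 < n ^ k := Nat.pow_pos (by omega)
    have h5 : n ^ k * (E.card * 2 ^ t) ≤ n ^ k * 2 ^ n :=
      calc n ^ k * (E.card * 2 ^ t) = E.card * (n ^ k * 2 ^ t) := by ring
        _ ≤ E.card * 2 ^ ℓ := h4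
        _ ≤ n ^ k * 2 ^ n := h3
    exact Nat.le_of_mul_le_mul_left h5 hnk
  -- the one-sided hypothesis for `P` (with `A = d + 1`)
  have hSP := hn1 P hPdeg
  -- the top block `T`
  set T : Finset ℕ := Finset.Ico (2 ^ (n - 1)) (2 ^ n) with hT
  have hmemT : ∀ {N : ℕ}, N ∈ T → N < 2 ^ n ∧ Nat.testBit N (n - 1) = true := by
    intro N hN
    rw [hT, Finset.mem_Ico] at hN
    refine ⟨hN.2, Nat.testBit_of_two_pow_le_and_two_pow_add_one_gt hN.1 ?_⟩
    rw [Nat.sub_add_cancel (by omega : 1 ≤ n)]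
    exact hN.2
  have hcardT : (2 : ℝ) ^ n = 2 * (T.card : ℝ) := by
    have hpow : 2 ^ n = 2 * 2 ^ (n - 1) := by
      rw [← pow_succ']
      congr 1
      omega
    have h1 : T.card = 2 ^ (n - 1) := by
      rw [hT, Nat.card_Ico]
      omega
    have h3 : 2 ^ n = 2 * T.card := by rw [h1]; exact hpow
    exact_mod_cast h3
  -- pointwise facts on `T`
  have hlam : ∀ {N : ℕ}, N ∈ T →
      ArithmeticFunction.liouville N = 1 ∨ ArithmeticFunction.liouville N = -1 := by
    intro N hN
    have hN0 : N ≠ 0 := by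
      rintro rfl
      exact absurd (hmemT hN).2 (by simp)
    rw [ArithmeticFunction.liouville_apply hN0]
    exact neg_one_pow_eq_or ℤ _
  have h01 : (0 : ZMod 2) ≠ 1 := by decide
  have hgood : ∀ N ∈ T, ¬ (fun i : Fin n => Nat.testBit N i) ∈ E →
      ((ArithmeticFunction.liouville N : ℤ) : ℝ) *
        (if MvPolynomial.eval (fun i : Fin n => if Nat.testBit N i then (1 : ZMod 2) else 0) P = 1
          then (-1 : ℝ) else 1) = 1 := by
    intro N hN hNE
    obtain ⟨hNlt, hNtop⟩ := hmemT hN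
    have hmem := ofFn_mem_toLanguage_iff {N : ℕ | ArithmeticFunction.liouville N = -1} hNlt hNtop
    rw [hPeval (fun i : Fin n => Nat.testBit N i), hagree _ hNE, hdec.eval_eq]
    rcases hlam hN with h1 | h1
    · have hnot : List.ofFn (fun i : Fin n => Nat.testBit N i) ∉
          Computability.encodingNatBool.toLanguage
            {N : ℕ | ArithmeticFunction.liouville N = -1} := by
        rw [hmem]
        simp [h1]
      rw [(Set.notMem_iff_boolIndicator _ _).1 hnot, h1]
      simp [h01]
    · have hin : List.ofFn (fun i : Fin n => Nat.testBit N i) ∈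
          Computability.encodingNatBool.toLanguage
            {N : ℕ | ArithmeticFunction.liouville N = -1} := by
        rw [hmem]
        exact h1
      rw [(Set.mem_iff_boolIndicator _ _).1 hin, h1]
      simp
  have hbad : ∀ N ∈ T, (-1 : ℝ) ≤
      ((ArithmeticFunction.liouville N : ℤ) : ℝ) *
        (if MvPolynomial.eval (fun i : Fin n => if Nat.testBit N i then (1 : ZMod 2) else 0) P = 1
          then (-1 : ℝ) else 1) := by
    intro N hN
    rcases hlam hN with h1 | h1 <;> rw [h1] <;> split_ifs <;> norm_num
  -- the errors inside `T` are at most `|E|`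
  have hfilt : (T.filter fun N => (fun i : Fin n => Nat.testBit N i) ∈ E).card ≤ E.card := by
    refine Finset.card_le_card_of_injOn (fun N => fun i : Fin n => Nat.testBit N i) ?_ ?_
    · intro N hN
      have hN' := Finset.mem_filter.1 (Finset.mem_coe.1 hN)
      exact Finset.mem_coe.2 hN'.2
    · refine (testBit_injOn n).mono fun N hN => ?_
      have hN' := Finset.mem_filter.1 (Finset.mem_coe.1 hN)
      exact Finset.mem_coe.2 (Finset.mem_range.2 (hmemT hN'.1).1)
  -- lower bound on the `T`-sum
  have hlow := card_sub_le_sum (T := T) (fun N => (fun i : Fin n => Nat.testBit N i) ∈ E) hgood hbad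
  -- contradiction
  have h2n : (0 : ℝ) < 2 ^ n := pow_pos two_pos n
  have h2t : (0 : ℝ) < 2 ^ t := pow_pos two_pos t
  have hEt' : (E.card : ℝ) * 2 ^ t ≤ (2 : ℝ) ^ n := by exact_mod_cast hEt
  have hfilt' : ((T.filter fun N => (fun i : Fin n => Nat.testBit N i) ∈ E).card : ℝ) ≤ E.card := by
    exact_mod_cast hfilt
  have hkey : 2 * (E.card : ℝ) < c * 2 ^ n := by
    refine lt_of_mul_lt_mul_right ?_ h2t.le
    calc 2 * (E.card : ℝ) * 2 ^ t = 2 * ((E.card : ℝ) * 2 ^ t) := by ring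
      _ ≤ 2 * 2 ^ n := by linarith
      _ < c * 2 ^ t * 2 ^ n := mul_lt_mul_of_pos_right ht h2n
      _ = c * 2 ^ n * 2 ^ t := by ring
  rw [sub_mul] at hSP
  linarith

end Summit.QuantumAdvantage.DigitPolyUniformity.SketchLAR
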